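import Literature.Probability.RandomPlanarGeometry.RectangleSCSymmetry
import Literature.Probability.RandomPlanarGeometry.RectangleSCInjective
import HarnessLib

/-!
# The conformal modulus of a rectangle: proof of `rectangle_crossRatio_eq_elliptic`

This file discharges the named fact
`Literature.Probability.RandomPlanarGeometry.rectangle_crossRatio_eq_elliptic`
(`RectangleModulus.lean`; Bollobás–Riordan, *Percolation* (2006), Ch. 7 §7.1, p. 185): for
`0 < k < 1`, every uniformizing datum `(φ, x)` of an axis-parallel rectangle `(0,w) × (0,h)` with
`w/h = 2K(k²)/K(1-k²)` and corners marked `ih, 0, w, w + ih` has Cardy cross-ratio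
`(1-k)²/(1+k)²`.

Proof. By the conformal invariance of the cross-ratio, a theorem of the tree
(`ConformalRectangle.crossRatio_eq_of_isUniformizing_holds`, `ConformalRectangleProofs.lean`), it
suffices to exhibit ONE uniformizing datum with prevertices `(-1/k, -1, 1, 1/k)` (whose cross-ratio
is `(1-k)²/(1+k)²`, `crossRatio_scrPrevertex`). This is the Schwarz–Christoffel map
`F_k = scrFun k` of `RectangleSCIntegrand`/`Vertex`/`Symmetry`/`Injective`, rescaled by the real
affine map `z ↦ (h/H)(z + K)`, `K = K(k²)`, `H = K(1-k²)`. With the boundary values of those files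
(the corners `-K, K, -K + iH, K + iH` at the prevertices `-1, 1, -1/k, 1/k`; points of the four
closed sides at all other real points; `iH` at `∞`) and injectivity, the identification of the image
`F_k(ℍₒ) = (-K, K) × (0, H)` (`scrFun_image_eq`) is purely topological, exactly as in
`SchwarzChristoffelTriangle.lean` (a connectedness substitute for the argument principle):
the image `O` is open (inverse function theorem), every point of `closure O \ O` is a boundary
value (compactness, `mem_image_or_of_mem_closure_scrFun`), each open outer half-plane of the
rectangle is connected, misses `closure O \ O` and is not contained in the bounded set `O`, hence
misses `O`; so `O` lies in the open rectangle, and the open rectangle — connected, meeting `O` at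
`F_k(i/√k) = iH/2`, missing `closure O \ O` — lies in `O`. The holomorphic inverse comes from
`Complex.differentiableOn_invFunOn_image`, packaged by `ConformalEquiv.ofBijOn`.

Main results: `scrFun_image_eq`, `scrFun_bijOn`, `exists_isUniformizing_rectangle` (the explicit
uniformizing datum of `(0,w)×(0,h)`), `rectangle_crossRatio_eq_elliptic_holds`.

## References

* B. Bollobás, O. Riordan, *Percolation*, CUP (2006), Ch. 7 §7.1, pp. 183–185.
* L. V. Ahlfors, *Complex Analysis*, 3rd ed. (1979), Ch. 6 §2.2–2.3.
* Z. Nehari, *Conformal Mapping*, McGraw-Hill (1952), Ch. V §6.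
-/

open Set Filter Topology Complex MeasureTheory Metric
open scoped Real Interval ComplexConjugate
open UpperHalfPlane (upperHalfPlaneSet isOpen_upperHalfPlaneSet)

noncomputable section

namespace Literature.Probability.RandomPlanarGeometry

variable {k : ℝ}

/-! ### Positivity of the two complete integrals -/

/-- `K = K(k²) > 0` for `0 < k < 1`. [folklore] -/
theorem ellipticK_sq_pos (hk0 : 0 < k) (hk1 : k < 1) : 0 < ellipticK (k ^ 2) :=
  ellipticK_pos (by positivity) (by nlinarith)

/-- `H = K(1-k²) > 0` for `0 < k < 1`. [folklore] -/
theorem ellipticK_one_sub_sq_pos (hk0 : 0 < k) (hk1 : k < 1) : 0 < ellipticK (1 - k ^ 2) :=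
  ellipticK_pos (by nlinarith) (by nlinarith)

/-! ### The image is open; all real points have boundary values -/

/-- The image `F_k(ℍₒ)` is open (inverse function theorem, `F_k′ = f_k ≠ 0`). [folklore] -/
theorem isOpen_scrFun_image (hk0 : 0 ≤ k) (hk1 : k ≤ 1) : IsOpen (scrFun k '' upperHalfPlaneSet) :=
  Complex.isOpen_image_of_deriv_ne_zero isOpen_upperHalfPlaneSet (differentiableOn_scrFun_upperHalfPlaneSet hk0 hk1)
    fun _ hz => deriv_scrFun_ne_zero hk0 hk1 hz

/-- `F_k` has a limit within `ℍₒ` at every real point (prevertices, the four open sides). [folklore] -/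
theorem exists_tendsto_scrFun_real (hk0 : 0 < k) (hk1 : k < 1) (u : ℝ) :
    ∃ y, Tendsto (scrFun k) (𝓝[upperHalfPlaneSet] (u : ℂ)) (𝓝 y) := by
  have hk : (1 : ℝ) < k⁻¹ := one_lt_inv_iff₀.2 ⟨hk0, hk1⟩
  rcases lt_trichotomy |u| k⁻¹ with hu | hu | hu
  · rw [abs_lt] at hu
    rcases lt_trichotomy u (-1) with h1 | h1 | h1
    · exact ⟨_, tendsto_scrFun_of_mem_Ioo_neg hk0 hk1 ⟨hu.1, h1⟩⟩
    · subst h1; exact ⟨_, by simpa using tendsto_scrFun_neg_one hk0 hk1⟩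
    rcases lt_trichotomy u 1 with h2 | h2 | h2
    · exact ⟨_, tendsto_scrFun_ofReal hk0.le hk1.le ⟨h1, h2⟩⟩
    · subst h2; exact ⟨_, by simpa using tendsto_scrFun_one hk0 hk1⟩
    · exact ⟨_, tendsto_scrFun_of_mem_Ioo_one_inv hk0 hk1 ⟨h2, hu.2⟩⟩
  · rcases le_or_gt 0 u with h | h
    · rw [abs_of_nonneg h] at hu; subst hu
      exact ⟨_, tendsto_scrFun_inv hk0 hk1⟩
    · rw [abs_of_neg h] at hu
      have : u = -k⁻¹ := by linarith
      subst this
      exact ⟨_, tendsto_scrFun_neg_inv hk0 hk1⟩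
  · exact ⟨_, tendsto_scrFun_of_inv_lt_abs hk0 hk1 hu⟩

/-- `F_k` has a limit within `ℍₒ` at every point of the closed upper half-plane. [folklore] -/
theorem exists_tendsto_scrFun_of_im_nonneg (hk0 : 0 < k) (hk1 : k < 1) {x : ℂ} (hx : 0 ≤ x.im) :
    ∃ y, Tendsto (scrFun k) (𝓝[upperHalfPlaneSet] x) (𝓝 y) := by
  rcases hx.lt_or_eq with hx | hx
  · exact ⟨scrFun k x, (differentiableOn_scrFun_upperHalfPlaneSet hk0.le hk1.le).continuousOn x hx⟩
  · have : ((x.re : ℝ) : ℂ) = x := Complex.ext (by simp) (by simp [← hx])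
    rw [← this]
    exact exists_tendsto_scrFun_real hk0 hk1 x.re

/-! ### The continuous extension to the closed half-plane; cluster values; boundedness -/

/-- The extension of `F_k` to `{im ≥ 0}` by boundary values. [folklore] -/
def scrFunExt (k : ℝ) : ℂ → ℂ := extendFrom upperHalfPlaneSet (scrFun k)

/-- The extension is continuous on the closed half-plane `{im ≥ 0} = closure ℍₒ`. [folklore] -/
theorem continuousOn_scrFunExt (hk0 : 0 < k) (hk1 : k < 1) : ContinuousOn (scrFunExt k) {z : ℂ | 0 ≤ z.im} :=
  continuousOn_extendFrom (fun _ hz => mem_closure_upperHalfPlaneSet_iff.2 hz)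
    fun _ hx => exists_tendsto_scrFun_of_im_nonneg hk0 hk1 hx

/-- The extension agrees with `F_k` on `ℍₒ`. [folklore] -/
theorem scrFunExt_eq (hk0 : 0 < k) (hk1 : k < 1) {w : ℂ} (hw : w ∈ upperHalfPlaneSet) : scrFunExt k w = scrFun k w :=
  extendFrom_extends (differentiableOn_scrFun_upperHalfPlaneSet hk0.le hk1.le).continuousOn w hw

/-- At a real point the extension is the boundary value. [folklore] -/
theorem tendsto_scrFun_scrFunExt (hk0 : 0 < k) (hk1 : k < 1) {w : ℂ} (hw : w.im = 0) :
    Tendsto (scrFun k) (𝓝[upperHalfPlaneSet] w) (𝓝 (scrFunExt k w)) := by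
  obtain ⟨y, hy⟩ := exists_tendsto_scrFun_of_im_nonneg hk0 hk1 hw.symm.le
  rwa [scrFunExt, extendFrom_eq (mem_closure_upperHalfPlaneSet_iff.2 hw.symm.le) hy]

/-- **Cluster values are boundary values.** A point of `closure F_k(ℍₒ)` is in `F_k(ℍₒ)`, or is the
value `iH` at `∞`, or is the boundary value of `F_k` at a real point. [folklore] -/
theorem mem_image_or_of_mem_closure_scrFun (hk0 : 0 < k) (hk1 : k < 1) {p : ℂ}
    (hp : p ∈ closure (scrFun k '' upperHalfPlaneSet)) :
    p ∈ scrFun k '' upperHalfPlaneSet ∨ p = I * (ellipticK (1 - k ^ 2) : ℂ) ∨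
      ∃ u : ℝ, Tendsto (scrFun k) (𝓝[upperHalfPlaneSet] (u : ℂ)) (𝓝 p) := by
  by_cases hpζ : p = I * (ellipticK (1 - k ^ 2) : ℂ)
  · exact Or.inr (Or.inl hpζ)
  obtain ⟨Vp, Vζ, hVp, hVζ, hpV, hζV, hdisj⟩ := t2_separation hpζ
  have h1 : scrFun k ⁻¹' Vζ ∈ cocompact ℂ ⊓ 𝓟 upperHalfPlaneSet :=
    tendsto_scrFun_atInfty hk0 hk1 (hVζ.mem_nhds hζV)
  rw [mem_inf_principal, Filter.mem_cocompact] at h1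
  obtain ⟨K, hK, hKsub⟩ := h1
  set C : Set ℂ := K ∩ {z : ℂ | 0 ≤ z.im} with hCdef
  have hC : IsCompact C := hK.inter_right (isClosed_le continuous_const continuous_im)
  have hCimg : IsClosed (scrFunExt k '' C) :=
    (hC.image_of_continuousOn ((continuousOn_scrFunExt hk0 hk1).mono inter_subset_right)).isClosed
  have h2 : scrFun k '' upperHalfPlaneSet ∩ Vp ⊆ scrFunExt k '' C := by
    rintro _ ⟨⟨w, hw, rfl⟩, hV⟩
    have hwK : w ∈ K := by
      by_contra hwK
      exact disjoint_left.1 hdisj hV (hKsub hwK hw)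
    exact ⟨w, ⟨hwK, show (0 : ℝ) ≤ w.im from le_of_lt hw⟩, scrFunExt_eq hk0 hk1 hw⟩
  have h3 : p ∈ closure (scrFun k '' upperHalfPlaneSet ∩ Vp) := hVp.closure_inter ⟨hp, hpV⟩
  have h4 : p ∈ scrFunExt k '' C := by
    rw [← hCimg.closure_eq]
    exact closure_mono h2 h3
  obtain ⟨w, ⟨-, hwim⟩, hwp⟩ := h4
  have hwim' : (0 : ℝ) ≤ w.im := hwim
  rcases hwim'.lt_or_eq with hw | hw
  · left
    rw [← hwp, scrFunExt_eq hk0 hk1 hw]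
    exact ⟨w, hw, rfl⟩
  · right; right
    refine ⟨w.re, ?_⟩
    have hwre : ((w.re : ℝ) : ℂ) = w := Complex.ext (by simp) (by simp [← hw])
    rw [hwre, ← hwp]
    exact tendsto_scrFun_scrFunExt hk0 hk1 hw.symm

/-- **The image `F_k(ℍₒ)` is bounded**: near `∞` the values are close to `iH`, and on the remaining
compact part of the closed half-plane the continuous extension is bounded. [folklore] -/
theorem isBounded_scrFun_image (hk0 : 0 < k) (hk1 : k < 1) : Bornology.IsBounded (scrFun k '' upperHalfPlaneSet) := by
  set ζ : ℂ := I * (ellipticK (1 - k ^ 2) : ℂ) with hζ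
  have h1 : scrFun k ⁻¹' ball ζ 1 ∈ cocompact ℂ ⊓ 𝓟 upperHalfPlaneSet :=
    tendsto_scrFun_atInfty hk0 hk1 (ball_mem_nhds ζ one_pos)
  rw [mem_inf_principal, Filter.mem_cocompact] at h1
  obtain ⟨K, hK, hKsub⟩ := h1
  set C : Set ℂ := K ∩ {z : ℂ | 0 ≤ z.im} with hCdef
  have hC : IsCompact C := hK.inter_right (isClosed_le continuous_const continuous_im)
  have hCb : Bornology.IsBounded (scrFunExt k '' C) :=
    (hC.image_of_continuousOn ((continuousOn_scrFunExt hk0 hk1).mono inter_subset_right)).isBounded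
  refine ((hCb.union (isBounded_ball (x := ζ) (r := 1))).subset ?_)
  rintro _ ⟨w, hw, rfl⟩
  by_cases hwK : w ∈ K
  · exact Or.inl ⟨w, ⟨hwK, show (0 : ℝ) ≤ w.im from le_of_lt hw⟩, scrFunExt_eq hk0 hk1 hw⟩
  · exact Or.inr (hKsub hwK hw)

/-! ### The rectangle, its outer half-planes, and the admissible boundary values -/

/-- The open Schwarz–Christoffel rectangle `(-K, K) × (0, H)`, `K = K(k²)`, `H = K(1-k²)`
(Bollobás–Riordan (2006), p. 185: corners `±K(k²)`, `±K(k²) + K(1-k²)√-1`). [cite: BollobasRiordan2006, Ch. 7 §7.1 p. 185] -/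
def scrRect (k : ℝ) : Set ℂ := Ioo (-ellipticK (k ^ 2)) (ellipticK (k ^ 2)) ×ℂ Ioo 0 (ellipticK (1 - k ^ 2))

/-- The four open outer half-planes of the rectangle: below `im = 0`, right of `re = K`, above
`im = H`, left of `re = -K`. [folklore] -/
def scrOuter (k : ℝ) : Fin 4 → Set ℂ :=
  ![openHalfPlane 0 (-1) 0, openHalfPlane 1 0 (ellipticK (k ^ 2)), openHalfPlane 0 1 (ellipticK (1 - k ^ 2)),
    openHalfPlane (-1) 0 (ellipticK (k ^ 2))]

/-- Each outer half-plane is preconnected. [folklore] -/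
theorem isPreconnected_scrOuter (k : ℝ) (i : Fin 4) : IsPreconnected (scrOuter k i) := by
  fin_cases i <;> exact isPreconnected_openHalfPlane _ _ _

/-- Each outer half-plane contains points of arbitrarily large norm (it is not bounded). [folklore] -/
theorem exists_mem_scrOuter_norm_gt (k : ℝ) (i : Fin 4) (R : ℝ) : ∃ q ∈ scrOuter k i, R < ‖q‖ := by
  set M : ℝ := |R| + |ellipticK (k ^ 2)| + |ellipticK (1 - k ^ 2)| + 1 with hM
  have hR : R < M := by
    rw [hM]; linarith [le_abs_self R, abs_nonneg (ellipticK (k ^ 2)), abs_nonneg (ellipticK (1 - k ^ 2))]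
  have hK : ellipticK (k ^ 2) < M := by
    rw [hM]; linarith [abs_nonneg R, le_abs_self (ellipticK (k ^ 2)), abs_nonneg (ellipticK (1 - k ^ 2))]
  have hH : ellipticK (1 - k ^ 2) < M := by
    rw [hM]; linarith [abs_nonneg R, abs_nonneg (ellipticK (k ^ 2)), le_abs_self (ellipticK (1 - k ^ 2))]
  have hM0 : 0 < M := by
    rw [hM]; linarith [abs_nonneg R, abs_nonneg (ellipticK (k ^ 2)), abs_nonneg (ellipticK (1 - k ^ 2))]
  have hnR : ‖(M : ℂ)‖ = M := by rw [Complex.norm_real, Real.norm_of_nonneg hM0.le]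
  have hnI : ‖(M : ℂ) * I‖ = M := by rw [norm_mul, Complex.norm_I, mul_one, hnR]
  fin_cases i
  · refine ⟨-((M : ℂ) * I), by simp [scrOuter, openHalfPlane, hM0], ?_⟩
    rwa [norm_neg, hnI]
  · refine ⟨(M : ℂ), by simp [scrOuter, openHalfPlane, hK], ?_⟩
    rwa [hnR]
  · refine ⟨(M : ℂ) * I, by simp [scrOuter, openHalfPlane, hH], ?_⟩
    rwa [hnI]
  · refine ⟨-(M : ℂ), by simp [scrOuter, openHalfPlane]; linarith, ?_⟩
    rwa [norm_neg, hnR]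

/-- The open rectangle misses the closure of each outer half-plane. [folklore] -/
theorem scrRect_subset_compl_closure (k : ℝ) (i : Fin 4) : scrRect k ⊆ (closure (scrOuter k i))ᶜ := by
  intro z hz hzc
  rw [scrRect, mem_reProdIm] at hz
  obtain ⟨⟨h1, h2⟩, h3, h4⟩ := hz
  have key : ∀ (a b c : ℝ), z ∈ closure (openHalfPlane a b c) → c ≤ a * z.re + b * z.im := by
    intro a b c h
    have hcl : IsClosed {w : ℂ | c ≤ a * w.re + b * w.im} :=
      isClosed_le continuous_const (by fun_prop)
    have hsub : openHalfPlane a b c ⊆ {w : ℂ | c ≤ a * w.re + b * w.im} :=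
      fun w (hw : c < a * w.re + b * w.im) => show c ≤ a * w.re + b * w.im from le_of_lt hw
    exact closure_minimal hsub hcl h
  fin_cases i
  · have := key 0 (-1) 0 hzc; simp at this; linarith
  · have := key 1 0 _ hzc; simp at this; linarith
  · have := key 0 1 _ hzc; simp at this; linarith
  · have := key (-1) 0 _ hzc; simp at this; linarith

/-- The set of admissible boundary values: points of the closed rectangle (in no outer half-plane)
lying on one of the four side lines (in the closure of some outer half-plane). [folklore] -/
def scrGood (k : ℝ) : Set ℂ := {p : ℂ | (∀ i, p ∉ scrOuter k i) ∧ ∃ i, p ∈ closure (scrOuter k i)}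

/-- A bottom-side point `x ∈ [-K, K]` is admissible. [folklore] -/
theorem bottom_mem_scrGood (hk0 : 0 < k) (hk1 : k < 1) {x : ℝ}
    (hx : x ∈ Icc (-ellipticK (k ^ 2)) (ellipticK (k ^ 2))) : ((x : ℝ) : ℂ) ∈ scrGood k := by
  have hH := ellipticK_one_sub_sq_pos hk0 hk1
  refine ⟨fun i => ?_, ⟨0, ?_⟩⟩
  · fin_cases i <;> simp [scrOuter, openHalfPlane] <;> linarith [hx.1, hx.2]
  · exact mem_closure_openHalfPlane (by norm_num) (by simp)

/-- A right-side point `K + iv`, `v ∈ [0, H]`, is admissible. [folklore] -/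
theorem right_mem_scrGood (hk0 : 0 < k) (hk1 : k < 1) {v : ℝ} (hv : v ∈ Icc 0 (ellipticK (1 - k ^ 2))) :
    (ellipticK (k ^ 2) : ℂ) + I * v ∈ scrGood k := by
  have hK := ellipticK_sq_pos hk0 hk1
  refine ⟨fun i => ?_, ⟨1, ?_⟩⟩
  · fin_cases i <;> simp [scrOuter, openHalfPlane] <;> linarith [hv.1, hv.2]
  · exact mem_closure_openHalfPlane (by norm_num) (by simp)

/-- A top-side point `x + iH`, `x ∈ [-K, K]`, is admissible. [folklore] -/
theorem top_mem_scrGood (hk0 : 0 < k) (hk1 : k < 1) {x : ℝ} (hx : x ∈ Icc (-ellipticK (k ^ 2)) (ellipticK (k ^ 2))) :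
    ((x : ℝ) : ℂ) + I * (ellipticK (1 - k ^ 2) : ℂ) ∈ scrGood k := by
  have hH := ellipticK_one_sub_sq_pos hk0 hk1
  refine ⟨fun i => ?_, ⟨2, ?_⟩⟩
  · fin_cases i <;> simp [scrOuter, openHalfPlane] <;> linarith [hx.1, hx.2]
  · exact mem_closure_openHalfPlane (by norm_num) (by simp)

/-- A left-side point `-K + iv`, `v ∈ [0, H]`, is admissible. [folklore] -/
theorem left_mem_scrGood (hk0 : 0 < k) (hk1 : k < 1) {v : ℝ} (hv : v ∈ Icc 0 (ellipticK (1 - k ^ 2))) :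
    -(ellipticK (k ^ 2) : ℂ) + I * v ∈ scrGood k := by
  have hK := ellipticK_sq_pos hk0 hk1
  refine ⟨fun i => ?_, ⟨3, ?_⟩⟩
  · fin_cases i <;> simp [scrOuter, openHalfPlane] <;> linarith [hv.1, hv.2]
  · exact mem_closure_openHalfPlane (by norm_num) (by simp)

/-- **Every boundary value of `F_k` at a real point is admissible** (it lies on one of the four closed
sides of the rectangle). [folklore] -/
theorem mem_scrGood_of_tendsto (hk0 : 0 < k) (hk1 : k < 1) {u : ℝ} {p : ℂ}
    (h : Tendsto (scrFun k) (𝓝[upperHalfPlaneSet] (u : ℂ)) (𝓝 p)) : p ∈ scrGood k := by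
  haveI := neBot_nhdsWithin_upperHalfPlaneSet u
  have hk : (1 : ℝ) < k⁻¹ := one_lt_inv_iff₀.2 ⟨hk0, hk1⟩
  have hk2 : (0 : ℝ) ≤ k ^ 2 := by positivity
  have hk2' : k ^ 2 < 1 := by nlinarith
  have hH := ellipticK_one_sub_sq_pos hk0 hk1
  have hK := ellipticK_sq_pos hk0 hk1
  rcases lt_trichotomy |u| k⁻¹ with hu | hu | hu
  · rw [abs_lt] at hu
    rcases lt_trichotomy u (-1) with h1 | h1 | h1
    · -- left side
      rw [tendsto_nhds_unique h (tendsto_scrFun_of_mem_Ioo_neg hk0 hk1 ⟨hu.1, h1⟩)]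
      have hx' : -u ∈ Ioo (1 : ℝ) k⁻¹ := ⟨by linarith, by linarith [hu.1]⟩
      exact left_mem_scrGood hk0 hk1 ⟨scrV_nonneg hk0 hk1 ⟨hx'.1.le, hx'.2⟩, scrV_le hk0 hk1 hx'⟩
    · subst h1
      have h' := tendsto_scrFun_neg_one hk0 hk1
      rw [show (-1 : ℂ) = ((-1 : ℝ) : ℂ) by push_cast; ring] at h'
      rw [tendsto_nhds_unique h h']
      have := bottom_mem_scrGood hk0 hk1 (x := -ellipticK (k ^ 2)) ⟨le_rfl, by linarith⟩
      simpa using this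
    rcases lt_trichotomy u 1 with h2 | h2 | h2
    · -- bottom side
      rw [tendsto_nhds_unique h (tendsto_scrFun_ofReal hk0.le hk1.le ⟨h1, h2⟩)]
      exact bottom_mem_scrGood hk0 hk1 (ellipticF_mem_Icc hk2 hk2' ⟨h1.le, h2.le⟩)
    · subst h2
      have h' := tendsto_scrFun_one hk0 hk1
      rw [show (1 : ℂ) = ((1 : ℝ) : ℂ) by push_cast; ring] at h'
      rw [tendsto_nhds_unique h h']
      exact bottom_mem_scrGood hk0 hk1 (x := ellipticK (k ^ 2)) ⟨by linarith, le_rfl⟩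
    · -- right side
      rw [tendsto_nhds_unique h (tendsto_scrFun_of_mem_Ioo_one_inv hk0 hk1 ⟨h2, hu.2⟩)]
      exact right_mem_scrGood hk0 hk1 ⟨scrV_nonneg hk0 hk1 ⟨h2.le, hu.2⟩, scrV_le hk0 hk1 ⟨h2, hu.2⟩⟩
  · rcases le_or_gt 0 u with h0 | h0
    · rw [abs_of_nonneg h0] at hu; subst hu
      rw [tendsto_nhds_unique h (tendsto_scrFun_inv hk0 hk1)]
      have := right_mem_scrGood hk0 hk1 (v := ellipticK (1 - k ^ 2)) ⟨hH.le, le_rfl⟩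
      simpa using this
    · rw [abs_of_neg h0] at hu
      have : u = -k⁻¹ := by linarith
      subst this
      rw [tendsto_nhds_unique h (tendsto_scrFun_neg_inv hk0 hk1)]
      have := left_mem_scrGood hk0 hk1 (v := ellipticK (1 - k ^ 2)) ⟨hH.le, le_rfl⟩
      simpa using this
  · -- top side
    rw [tendsto_nhds_unique h (tendsto_scrFun_of_inv_lt_abs hk0 hk1 hu)]
    have hmem := ellipticF_mem_Icc hk2 hk2' (x := -(k * u)⁻¹)
      ⟨(scrMoeb_ofReal_mem_Ioo hk0 hu).1.le, (scrMoeb_ofReal_mem_Ioo hk0 hu).2.le⟩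
    have := top_mem_scrGood hk0 hk1 (x := -ellipticF (k ^ 2) (-(k * u)⁻¹)) ⟨by linarith [hmem.2], by linarith [hmem.1]⟩
    convert this using 1
    push_cast
    ring

/-- The value `iH` at `∞` is admissible (midpoint of the top side). [folklore] -/
theorem apex_mem_scrGood (hk0 : 0 < k) (hk1 : k < 1) : I * (ellipticK (1 - k ^ 2) : ℂ) ∈ scrGood k := by
  have hK := ellipticK_sq_pos hk0 hk1
  have := top_mem_scrGood hk0 hk1 (x := 0) ⟨by linarith, hK.le⟩
  simpa using this

/-- **`closure F_k(ℍₒ) ⊆ F_k(ℍₒ) ∪ scrGood`.** [folklore] -/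
theorem closure_scrFun_image_subset (hk0 : 0 < k) (hk1 : k < 1) :
    closure (scrFun k '' upperHalfPlaneSet) ⊆ scrFun k '' upperHalfPlaneSet ∪ scrGood k := by
  intro p hp
  rcases mem_image_or_of_mem_closure_scrFun hk0 hk1 hp with h | rfl | ⟨u, hu⟩
  · exact Or.inl h
  · exact Or.inr (apex_mem_scrGood hk0 hk1)
  · exact Or.inr (mem_scrGood_of_tendsto hk0 hk1 hu)

/-! ### The image is the open rectangle -/

/-- The image misses each outer half-plane: `Hᵢ` is connected, misses `closure F_k(ℍₒ) \ F_k(ℍₒ)`,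
and is not contained in the bounded set `F_k(ℍₒ)`. [folklore] -/
theorem scrFun_image_inter_scrOuter (hk0 : 0 < k) (hk1 : k < 1) (i : Fin 4) :
    scrFun k '' upperHalfPlaneSet ∩ scrOuter k i = ∅ := by
  by_contra hne
  have hne' : (scrOuter k i ∩ scrFun k '' upperHalfPlaneSet).Nonempty := by
    rw [inter_comm]; exact nonempty_iff_ne_empty.2 hne
  have hsub : scrOuter k i ⊆ scrFun k '' upperHalfPlaneSet := by
    refine (isPreconnected_scrOuter k i).subset_of_closure_inter_subset (isOpen_scrFun_image hk0.le hk1.le) hne' ?_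
    rintro p ⟨hpc, hpi⟩
    rcases closure_scrFun_image_subset hk0 hk1 hpc with h | h
    · exact h
    · exact absurd hpi (h.1 i)
  obtain ⟨R, hR⟩ := (isBounded_scrFun_image hk0 hk1).subset_closedBall 0
  obtain ⟨q, hq, hqR⟩ := exists_mem_scrOuter_norm_gt k i R
  have := hR (hsub hq)
  rw [mem_closedBall, dist_zero_right] at this
  linarith

/-- Points of the image lie in no outer half-plane. [folklore] -/
theorem not_mem_scrOuter_of_mem_image (hk0 : 0 < k) (hk1 : k < 1) {q : ℂ} (hq : q ∈ scrFun k '' upperHalfPlaneSet)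
    (i : Fin 4) : q ∉ scrOuter k i := fun h =>
  (eq_empty_iff_forall_notMem.1 (scrFun_image_inter_scrOuter hk0 hk1 i)) q ⟨hq, h⟩

/-- Points of the image lie strictly inside each side line. [folklore] -/
theorem not_mem_closure_scrOuter_of_mem_image (hk0 : 0 < k) (hk1 : k < 1) {q : ℂ}
    (hq : q ∈ scrFun k '' upperHalfPlaneSet) (i : Fin 4) : q ∉ closure (scrOuter k i) := by
  intro hcl
  rw [mem_closure_iff_nhds] at hcl
  obtain ⟨z, hzO, hzi⟩ := hcl _ ((isOpen_scrFun_image hk0.le hk1.le).mem_nhds hq)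
  have : z ∈ scrFun k '' upperHalfPlaneSet ∩ scrOuter k i := ⟨hzO, hzi⟩
  rw [scrFun_image_inter_scrOuter hk0 hk1 i] at this
  exact this

/-- **`F_k(ℍₒ) ⊆ (-K, K) × (0, H)`.** [folklore] -/
theorem scrFun_image_subset (hk0 : 0 < k) (hk1 : k < 1) : scrFun k '' upperHalfPlaneSet ⊆ scrRect k := by
  intro q hq
  have hn := not_mem_closure_scrOuter_of_mem_image hk0 hk1 hq
  have hn' := not_mem_scrOuter_of_mem_image hk0 hk1 hq
  rw [scrRect, mem_reProdIm]
  refine ⟨⟨?_, ?_⟩, ?_, ?_⟩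
  · by_contra hc
    rcases (not_lt.1 hc).eq_or_lt with hc | hc
    · exact hn 3 (mem_closure_openHalfPlane (by norm_num) (by simp; linarith))
    · exact hn' 3 (by simp [scrOuter, openHalfPlane]; linarith)
  · by_contra hc
    rcases (not_lt.1 hc).eq_or_lt with hc | hc
    · exact hn 1 (mem_closure_openHalfPlane (by norm_num) (by simp; linarith))
    · exact hn' 1 (by simp [scrOuter, openHalfPlane]; linarith)
  · by_contra hc
    rcases (not_lt.1 hc).eq_or_lt with hc | hc
    · exact hn 0 (mem_closure_openHalfPlane (by norm_num) (by simp; linarith))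
    · exact hn' 0 (by simp [scrOuter, openHalfPlane]; linarith)
  · by_contra hc
    rcases (not_lt.1 hc).eq_or_lt with hc | hc
    · exact hn 2 (mem_closure_openHalfPlane (by norm_num) (by simp; linarith))
    · exact hn' 2 (by simp [scrOuter, openHalfPlane]; linarith)

/-- The open rectangle is convex. [folklore] -/
theorem convex_scrRect (k : ℝ) : Convex ℝ (scrRect k) := by
  have h : convexHull ℝ (scrRect k) = scrRect k := by
    rw [scrRect, convexHull_reProdIm, (convex_Ioo _ _).convexHull_eq, (convex_Ioo _ _).convexHull_eq]
  rw [← h]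
  exact convex_convexHull ℝ _

/-- The centre value `F_k(i/√k) = iH/2` lies in the open rectangle. [folklore] -/
theorem scrFun_fixed_mem_scrRect (hk0 : 0 < k) (hk1 : k < 1) : scrFun k (I * ((Real.sqrt k)⁻¹ : ℝ)) ∈ scrRect k := by
  have hK := ellipticK_sq_pos hk0 hk1
  have hH := ellipticK_one_sub_sq_pos hk0 hk1
  rw [scrFun_fixed hk0 hk1, scrRect, mem_reProdIm]
  refine ⟨⟨?_, ?_⟩, ?_, ?_⟩ <;> simp <;> linarith

/-- **`(-K, K) × (0, H) ⊆ F_k(ℍₒ)`**: the rectangle is connected, meets the image, and misses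
`closure F_k(ℍₒ) \ F_k(ℍₒ)`. [folklore] -/
theorem subset_scrFun_image (hk0 : 0 < k) (hk1 : k < 1) : scrRect k ⊆ scrFun k '' upperHalfPlaneSet := by
  have hne : (scrRect k ∩ scrFun k '' upperHalfPlaneSet).Nonempty :=
    ⟨_, scrFun_fixed_mem_scrRect hk0 hk1, ⟨_, I_mul_inv_sqrt_mem hk0, rfl⟩⟩
  refine (convex_scrRect k).isPreconnected.subset_of_closure_inter_subset (isOpen_scrFun_image hk0.le hk1.le) hne ?_
  rintro p ⟨hpc, hpT⟩
  rcases closure_scrFun_image_subset hk0 hk1 hpc with h | ⟨-, i, hi⟩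
  · exact h
  · exact absurd hi (scrRect_subset_compl_closure k i hpT)

/-- **The image of `ℍₒ` under the Schwarz–Christoffel map is the open rectangle `(-K, K) × (0, H)`**
(Bollobás–Riordan (2006), p. 185). [cite: BollobasRiordan2006, Ch. 7 §7.1 p. 185] -/
theorem scrFun_image_eq (hk0 : 0 < k) (hk1 : k < 1) : scrFun k '' upperHalfPlaneSet = scrRect k :=
  Subset.antisymm (scrFun_image_subset hk0 hk1) (subset_scrFun_image hk0 hk1)

/-- `F_k` is a bijection of `ℍₒ` onto the open rectangle. [cite: BollobasRiordan2006, Ch. 7 §7.1 p. 185] -/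
theorem scrFun_bijOn (hk0 : 0 < k) (hk1 : k < 1) : BijOn (scrFun k) upperHalfPlaneSet (scrRect k) :=
  ⟨mapsTo_iff_image_subset.2 (scrFun_image_subset hk0 hk1), scrFun_injOn hk0.le hk1.le, subset_scrFun_image hk0 hk1⟩

/-! ### The rescaled map onto `(0, w) × (0, h)` and the uniformizing datum -/

/-- The prevertices `(-1/k, -1, 1, 1/k)` of Bollobás–Riordan's `U₄(k)`. [cite: BollobasRiordan2006, Ch. 7 §7.1 p. 185] -/
def scrPrevertex (k : ℝ) : Fin 4 → ℝ := ![-k⁻¹, -1, 1, k⁻¹]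

/-- The prevertices are strictly increasing (`0 < k < 1`). [folklore] -/
theorem strictMono_scrPrevertex (hk0 : 0 < k) (hk1 : k < 1) : StrictMono (scrPrevertex k) := by
  have hk : (1 : ℝ) < k⁻¹ := one_lt_inv_iff₀.2 ⟨hk0, hk1⟩
  refine Fin.strictMono_iff_lt_succ.2 fun i => ?_
  fin_cases i <;> simp [scrPrevertex] <;> linarith

/-- **The cross-ratio of `(-1/k, -1, 1, 1/k)` is `(1-k)²/(1+k)²`** (Bollobás–Riordan (2006),
p. 185: `η(U₄(k)) = (1-k)²/(1+k)²`). [cite: BollobasRiordan2006, Ch. 7 §7.1 p. 185] -/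
theorem crossRatio_scrPrevertex (hk0 : 0 < k) (hk1 : k < 1) :
    crossRatio (scrPrevertex k) = (1 - k) ^ 2 / (1 + k) ^ 2 := by
  have hk : k ≠ 0 := hk0.ne'
  have h1 : (1 : ℝ) + k ≠ 0 := by linarith
  have e0 : scrPrevertex k 0 = -k⁻¹ := rfl
  have e1 : scrPrevertex k 1 = -1 := rfl
  have e2 : scrPrevertex k 2 = 1 := rfl
  have e3 : scrPrevertex k 3 = k⁻¹ := rfl
  rw [crossRatio, e0, e1, e2, e3]
  have hk' : 0 < k⁻¹ := inv_pos.2 hk0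
  have hden : (-k⁻¹ - 1) * (-1 - k⁻¹) ≠ 0 :=
    mul_ne_zero (by linarith : -k⁻¹ - 1 < 0).ne (by linarith : -1 - k⁻¹ < 0).ne
  have h1sq : (1 + k) ^ 2 ≠ 0 := pow_ne_zero 2 h1
  rw [div_eq_div_iff hden h1sq]
  have huk : k⁻¹ * k = 1 := inv_mul_cancel₀ hk
  linear_combination (-4 * (k - k⁻¹)) * huk

/-- **The explicit uniformizing datum of the rectangle `(0,w) × (0,h)`** with
`w/h = 2K(k²)/K(1-k²)` (`h > 0`): the rescaled Schwarz–Christoffel map `z ↦ (h/H)(F_k(z) + K)` is a conformal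
equivalence of `ℍₒ` onto the rectangle with boundary values the corners `ih, 0, w, w + ih` at the
prevertices `-1/k, -1, 1, 1/k` (Bollobás–Riordan (2006), p. 185, up to the similarity `z ↦ (h/H)(z+K)`). [cite: BollobasRiordan2006, Ch. 7 §7.1 p. 185] -/
theorem exists_isUniformizing_rectangle (hk0 : 0 < k) (hk1 : k < 1) (R : ConformalRectangle) {w h : ℝ}
    (hh : 0 < h) (hratio : w / h = 2 * ellipticK (k ^ 2) / ellipticK (1 - k ^ 2))
    (hcar : R.carrier = (Ioo (0 : ℝ) w ×ℂ Ioo (0 : ℝ) h))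
    (hpt : R.pt 0 = (h : ℂ) * Complex.I ∧ R.pt 1 = 0 ∧ R.pt 2 = (w : ℂ) ∧ R.pt 3 = (w : ℂ) + (h : ℂ) * Complex.I) :
    ∃ φ : ConformalEquiv upperHalfPlaneSet R.carrier, R.IsUniformizing φ (scrPrevertex k) := by
  set K : ℝ := ellipticK (k ^ 2) with hKdef
  set H : ℝ := ellipticK (1 - k ^ 2) with hHdef
  have hK : 0 < K := ellipticK_sq_pos hk0 hk1
  have hH : 0 < H := ellipticK_one_sub_sq_pos hk0 hk1
  set a : ℝ := h / H with ha
  have ha0 : 0 < a := div_pos hh hH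
  have hwa : w = 2 * a * K := by
    rw [ha]; field_simp at hratio ⊢; linarith
  -- the rescaled map
  set Φ : ℂ → ℂ := fun z => (a : ℂ) * (scrFun k z + K) with hΦ
  have hA_bij : BijOn (fun z : ℂ => (a : ℂ) * (z + K)) (scrRect k) (Ioo (0 : ℝ) w ×ℂ Ioo (0 : ℝ) h) := by
    refine ⟨fun z hz => ?_, fun z₁ _ z₂ _ heq => ?_, fun p hp => ?_⟩
    · rw [scrRect, mem_reProdIm] at hz
      rw [mem_reProdIm]
      simp only [mul_re, ofReal_re, add_re, ofReal_im, add_im, zero_mul, sub_zero, mul_im, add_zero]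
      obtain ⟨⟨h1, h2⟩, h3, h4⟩ := hz
      refine ⟨⟨by nlinarith, by nlinarith⟩, by nlinarith, ?_⟩
      calc a * z.im < a * H := mul_lt_mul_of_pos_left h4 ha0
        _ = h := by rw [ha]; field_simp
    · have ha' : (a : ℂ) ≠ 0 := ofReal_ne_zero.2 ha0.ne'
      have := mul_left_cancel₀ ha' heq
      linear_combination this
    · rw [mem_reProdIm] at hp
      obtain ⟨⟨h1, h2⟩, h3, h4⟩ := hp
      refine ⟨(a : ℂ)⁻¹ * p - K, ?_, ?_⟩
      · rw [scrRect, mem_reProdIm]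
        have hre : ((a : ℂ)⁻¹ * p - K).re = a⁻¹ * p.re - K := by
          simp [mul_re, ← ofReal_inv]
        have him : ((a : ℂ)⁻¹ * p - K).im = a⁻¹ * p.im := by
          simp [mul_im, ← ofReal_inv]
        rw [hre, him]
        have hai : 0 < a⁻¹ := inv_pos.2 ha0
        refine ⟨⟨?_, ?_⟩, by positivity, ?_⟩
        · nlinarith [mul_pos hai h1]
        · have : a⁻¹ * p.re < a⁻¹ * w := mul_lt_mul_of_pos_left h2 hai
          rw [hwa] at this
          have e : a⁻¹ * (2 * a * K) = 2 * K := by field_simp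
          linarith
        · have : a⁻¹ * p.im < a⁻¹ * h := mul_lt_mul_of_pos_left h4 hai
          have e : a⁻¹ * h = H := by rw [ha]; field_simp
          linarith
      · have ha' : (a : ℂ) ≠ 0 := ofReal_ne_zero.2 ha0.ne'
        show (a : ℂ) * ((a : ℂ)⁻¹ * p - K + K) = p
        rw [sub_add_cancel, ← mul_assoc, mul_inv_cancel₀ ha', one_mul]
  have hbij : BijOn Φ upperHalfPlaneSet R.carrier := by
    rw [hcar]
    exact hA_bij.comp (scrFun_bijOn hk0 hk1)
  have hdiff : DifferentiableOn ℂ Φ upperHalfPlaneSet :=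
    ((differentiableOn_scrFun_upperHalfPlaneSet hk0.le hk1.le).add_const _).const_mul _
  have hderiv : ∀ z ∈ upperHalfPlaneSet, deriv Φ z ≠ 0 := by
    intro z hz
    have h := ((hasDerivAt_scrFun_of_mem hk0.le hk1.le hz).add_const (K : ℂ)).const_mul (a : ℂ)
    rw [h.deriv]
    exact mul_ne_zero (ofReal_ne_zero.2 ha0.ne') (scrDeriv_ne_zero hk0.le hk1.le (upperHalfPlaneSet_subset_scrDomain hz))
  have hinv : DifferentiableOn ℂ (Function.invFunOn Φ upperHalfPlaneSet) R.carrier := by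
    rw [← hbij.image_eq]
    exact Complex.differentiableOn_invFunOn_image isOpen_upperHalfPlaneSet hdiff hbij.injOn hderiv
  refine ⟨ConformalEquiv.ofBijOn Φ hdiff hbij hinv, Or.inl (strictMono_scrPrevertex hk0 hk1), fun i => ?_⟩
  -- boundary values at the prevertices
  have hcont : Continuous fun z : ℂ => (a : ℂ) * (z + K) := by fun_prop
  have hbv : ∀ {x : ℂ} {L : ℂ}, Tendsto (scrFun k) (𝓝[upperHalfPlaneSet] x) (𝓝 L) →
      Tendsto Φ (𝓝[upperHalfPlaneSet] x) (𝓝 ((a : ℂ) * (L + K))) := fun h => (hcont.tendsto _).comp h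
  have haH : (a : ℂ) * (H : ℂ) = h := by
    have hH' : (H : ℂ) ≠ 0 := ofReal_ne_zero.2 hH.ne'
    rw [ha]; push_cast; exact div_mul_cancel₀ _ hH' 
  show Tendsto Φ (𝓝[upperHalfPlaneSet] ((scrPrevertex k i : ℝ) : ℂ)) (𝓝 (R.pt i))
  fin_cases i
  · simp only [scrPrevertex, Fin.zero_eta, Matrix.cons_val_zero, hpt.1]
    have h := hbv (tendsto_scrFun_neg_inv hk0 hk1)
    convert h using 2
    rw [← haH]; ring
  · simp only [scrPrevertex, Fin.mk_one, Matrix.cons_val_one, Matrix.cons_val_zero, hpt.2.1]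
    have h := hbv (tendsto_scrFun_neg_one hk0 hk1)
    push_cast
    convert h using 2
    ring
  · simp only [scrPrevertex, Fin.reduceFinMk, Matrix.cons_val, hpt.2.2.1]
    have h := hbv (tendsto_scrFun_one hk0 hk1)
    push_cast
    convert h using 2
    rw [hwa]; push_cast; ring
  · simp only [scrPrevertex, Fin.reduceFinMk, Matrix.cons_val, hpt.2.2.2]
    have h := hbv (tendsto_scrFun_inv hk0 hk1)
    convert h using 2
    rw [hwa, ← haH]; push_cast; ring

/-- **`rectangle_crossRatio_eq_elliptic` holds** (Bollobás–Riordan, *Percolation* (2006), Ch. 7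
§7.1, p. 185): for `0 < k < 1`, every axis-parallel rectangle `(0,w) × (0,h)` with
`w/h = 2K(k²)/K(1-k²)`, corners marked `ih, 0, w, w + ih`, has Cardy cross-ratio
`η = (1-k)²/(1+k)²` for every uniformizing datum: by conformal invariance of the cross-ratio
(`ConformalRectangle.crossRatio_eq_of_isUniformizing_holds`) and the explicit Schwarz–Christoffel
uniformizing datum with prevertices `(-1/k, -1, 1, 1/k)` (`exists_isUniformizing_rectangle`). [cite: BollobasRiordan2006, Ch. 7 §7.1 p. 185] -/
theorem rectangle_crossRatio_eq_elliptic_holds : rectangle_crossRatio_eq_elliptic := by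
  intro k hk0 hk1 R w h _ hh hratio hcar hpt φ x hφx
  obtain ⟨ψ, hψ⟩ := exists_isUniformizing_rectangle hk0 hk1 R hh hratio hcar hpt
  rw [ConformalRectangle.crossRatio_eq_of_isUniformizing_holds hφx hψ]
  exact crossRatio_scrPrevertex hk0 hk1

end Literature.Probability.RandomPlanarGeometry

end
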